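import Mathlib.Algebra.CharP.Frobenius
import Mathlib.Algebra.CharP.Algebra
import Mathlib.FieldTheory.Perfect
import Mathlib.RingTheory.FiniteType
import Mathlib.RingTheory.Localization.Defs
import Mathlib.Algebra.MvPolynomial.Equiv
import Mathlib.Algebra.Polynomial.Basic
import HarnessLib

/-!
# F-finite rings: `A` is finitely generated over its subring of `q`-th powers

Topic: `Literature/AlgebraicGeometry/Resolution`. The finiteness hypothesis of the theory of
F-blowups (`FBlowup.lean`, `FBlowupExistence.lean`: T. Yasuda, *Universal flattening of
Frobenius*, Amer. J. Math. 134 (2012), §2, works with varieties over a perfect field, for which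
`𝒪_X^{1/q}` is a coherent `𝒪_X`-module): a commutative ring `A` of characteristic `p` is
**F-finite (at level `e`)** if `A = ∑_{i} A^q sᵢ` for finitely many `sᵢ ∈ A`, `q = p^e`, i.e. the
Frobenius push-forward `F^e_* A` is a finitely generated `A`-module (E. Kunz, *Characterizations
of regular local rings of characteristic `p`*, Amer. J. Math. 91 (1969), §1; Kunz, *On
Noetherian rings of characteristic `p`*, Amer. J. Math. 98 (1976): F-finite rings). All PROVED:

* `IsFFinite p e A` — `∃ s : Fin n → A, ∀ a, a = ∑ᵢ cᵢ^q sᵢ` (elementary form; no characteristic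
  hypothesis is needed to state it);
* `IsFFinite.of_surjective` (quotients, isomorphic rings), `IsFFinite.of_isLocalization`
  (localisations), `IsFFinite.polynomial` (polynomial rings, generators `sᵢ X^k`, `k < q`),
  `isFFinite_of_perfectRing` (perfect rings, e.g. perfect fields), `IsFFinite.mvPolynomial_fin`,
  `IsFFinite.of_finiteType` — **algebras of finite type over an F-finite ring of characteristic
  `p` (e.g. over a perfect field) are F-finite**.

## Sources

* E. Kunz, Amer. J. Math. 91 (1969) 772–784, §1–2 (finiteness of `R` over `R^p`). [Kunz1969]
* T. Yasuda, Amer. J. Math. 134 (2012) = arXiv:0706.2700, §2 (conventions: varieties over a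
  perfect field). [Yasuda2012]
-/

noncomputable section

open Polynomial

namespace Literature.AlgebraicGeometry.Resolution

universe u v

section Def

/-- `A` is **F-finite at level `e`**: there are finitely many `s₁, …, sₙ ∈ A` such that every
`a ∈ A` is `∑ᵢ cᵢ^q sᵢ` with `cᵢ ∈ A`, `q = p^e` — i.e. `A` is a finitely generated module over its
subring `A^q` of `q`-th powers; for reduced `A` of characteristic `p`, equivalently, the
Frobenius push-forward `F^e_* A ≅ A^{1/q}` is a finitely generated `A`-module (Kunz).
[cite: Kunz1969, §1–2] -/
def IsFFinite (p : ℕ) (e : ℕ) (A : Type u) [CommRing A] : Prop :=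
  ∃ (n : ℕ) (s : Fin n → A), ∀ a : A, ∃ c : Fin n → A, a = ∑ i, c i ^ p ^ e * s i

end Def

variable {p : ℕ} {e : ℕ}

/-- F-finiteness from a generating family indexed by any finite type. [folklore] -/
theorem isFFinite_of_fintype {A : Type u} [CommRing A] {ι : Type v} [Fintype ι] (s : ι → A)
    (h : ∀ a : A, ∃ c : ι → A, a = ∑ i, c i ^ p ^ e * s i) : IsFFinite p e A := by
  classical
  refine ⟨Fintype.card ι, s ∘ (Fintype.equivFin ι).symm, fun a => ?_⟩
  obtain ⟨c, hc⟩ := h a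
  refine ⟨c ∘ (Fintype.equivFin ι).symm, ?_⟩
  rw [hc, ← (Fintype.equivFin ι).symm.sum_comp]
  rfl

/-- **Quotients (and isomorphic images) of F-finite rings are F-finite.** [cite: Kunz1969, §1] -/
theorem IsFFinite.of_surjective {A : Type u} {B : Type v} [CommRing A] [CommRing B]
    (h : IsFFinite p e A) (f : A →+* B) (hf : Function.Surjective f) : IsFFinite p e B := by
  obtain ⟨n, s, hs⟩ := h
  refine ⟨n, f ∘ s, fun b => ?_⟩
  obtain ⟨a, rfl⟩ := hf b
  obtain ⟨c, hc⟩ := hs a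
  refine ⟨f ∘ c, ?_⟩
  rw [hc, map_sum]
  simp only [map_mul, map_pow, Function.comp_apply]

/-- **Localisations of F-finite rings are F-finite**: `a/m = ∑ᵢ (cᵢ/m)^q sᵢ` where
`a m^{q-1} = ∑ᵢ cᵢ^q sᵢ`. [cite: Kunz1969, §1] -/
theorem IsFFinite.of_isLocalization {A : Type u} [CommRing A] [ExpChar A p] (h : IsFFinite p e A)
    (M : Submonoid A) (B : Type v) [CommRing B] [Algebra A B] [IsLocalization M B] :
    IsFFinite p e B := by
  obtain ⟨n, s, hs⟩ := h
  refine ⟨n, fun i => algebraMap A B (s i), fun b => ?_⟩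
  obtain ⟨⟨a, m⟩, hb⟩ := IsLocalization.surj M b
  obtain ⟨u, hu⟩ := (IsLocalization.map_units B m).exists_left_inv
  obtain ⟨q₀, hq₀⟩ : ∃ q₀ : ℕ, p ^ e = q₀ + 1 :=
    ⟨p ^ e - 1, (Nat.sub_add_cancel (Nat.one_le_pow _ _ (expChar_pos A p))).symm⟩
  obtain ⟨c, hc⟩ := hs (a * (m : A) ^ q₀)
  refine ⟨fun i => algebraMap A B (c i) * u, ?_⟩
  have key : b = u ^ p ^ e * algebraMap A B (a * (m : A) ^ q₀) := by
    rw [map_mul, map_pow, ← hb, hq₀]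
    calc b = b * (u * algebraMap A B m) ^ (q₀ + 1) := by rw [hu, one_pow, mul_one]
      _ = u ^ (q₀ + 1) * (b * algebraMap A B m * algebraMap A B m ^ q₀) := by ring
  rw [key, hc, map_sum, Finset.mul_sum]
  refine Finset.sum_congr rfl fun i _ => ?_
  rw [map_mul, map_pow, mul_pow]
  ring

/-- **Perfect rings are F-finite** (`A^q = A`, one generator `1`). [folklore] -/
theorem isFFinite_of_perfectRing (A : Type u) [CommRing A] (p : ℕ) [ExpChar A p] [PerfectRing A p]
    (e : ℕ) : IsFFinite p e A := by
  refine ⟨1, fun _ => 1, fun a => ?_⟩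
  obtain ⟨c, hc⟩ := (bijective_iterateFrobenius A p e).2 a
  refine ⟨fun _ => c, ?_⟩
  rw [Fin.sum_univ_one, mul_one, ← hc, iterateFrobenius_def]

/-- **Polynomial rings over F-finite rings of characteristic `p` are F-finite**: generators
`sᵢ X^k`, `k < q`, since `c X^{qt+k} = ∑ᵢ (cᵢ X^t)^q · sᵢ X^k` for `c = ∑ᵢ cᵢ^q sᵢ`.
[cite: Kunz1969, §1] -/
theorem IsFFinite.polynomial {A : Type u} [CommRing A] [ExpChar A p] (h : IsFFinite p e A) :
    IsFFinite p e A[X] := by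
  classical
  obtain ⟨n, s, hs⟩ := h
  have hq : 0 < p ^ e := Nat.pow_pos (expChar_pos A p)
  -- generators `s i * X^k`, `k < q`
  refine isFFinite_of_fintype (ι := Fin n × Fin (p ^ e))
    (fun ik => C (s ik.1) * X ^ (ik.2 : ℕ)) fun f => ?_
  induction f using Polynomial.induction_on' with
  | add f g hf hg =>
    obtain ⟨c, hc⟩ := hf
    obtain ⟨d, hd⟩ := hg
    refine ⟨c + d, ?_⟩
    rw [hc, hd, ← Finset.sum_add_distrib]
    refine Finset.sum_congr rfl fun ik _ => ?_
    rw [Pi.add_apply, add_pow_expChar_pow, add_mul]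
  | monomial m a =>
    obtain ⟨c, hc⟩ := hs a
    -- `m = q t + k`
    obtain ⟨t, k, hk, rfl⟩ : ∃ t k : ℕ, k < p ^ e ∧ m = p ^ e * t + k :=
      ⟨m / p ^ e, m % p ^ e, Nat.mod_lt _ hq, (Nat.div_add_mod m (p ^ e)).symm⟩
    refine ⟨fun ik => if ik.2 = ⟨k, hk⟩ then C (c ik.1) * X ^ t else 0, ?_⟩
    rw [Fintype.sum_prod_type, Finset.sum_comm, Finset.sum_eq_single ⟨k, hk⟩]
    · simp only [if_true]
      rw [← Polynomial.C_mul_X_pow_eq_monomial, hc, map_sum, Finset.sum_mul]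
      refine Finset.sum_congr rfl fun i _ => ?_
      rw [map_mul, map_pow, mul_pow, ← pow_mul, pow_add, pow_mul]
      ring
    · intro k' _ hk'
      simp [hk', zero_pow hq.ne']
    · intro h
      exact absurd (Finset.mem_univ _) h

/-- **Polynomial rings in finitely many variables over F-finite rings are F-finite.**
[cite: Kunz1969, §1] -/
theorem IsFFinite.mvPolynomial_fin {A : Type u} [CommRing A] [ExpChar A p] (h : IsFFinite p e A)
    (n : ℕ) : IsFFinite p e (MvPolynomial (Fin n) A) := by
  induction n with
  | zero =>
    exact h.of_surjective (MvPolynomial.isEmptyRingEquiv A (Fin 0)).symm.toRingHom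
      (MvPolynomial.isEmptyRingEquiv A (Fin 0)).symm.surjective
  | succ n ih =>
    haveI : ExpChar (MvPolynomial (Fin n) A) p :=
      expChar_of_injective_algebraMap (MvPolynomial.C_injective (Fin n) A) p
    exact ih.polynomial.of_surjective (MvPolynomial.finSuccEquiv A n).symm.toRingEquiv.toRingHom
      (MvPolynomial.finSuccEquiv A n).symm.surjective

/-- **Algebras of finite type over an F-finite ring of characteristic `p` are F-finite** (they
are quotients of polynomial rings in finitely many variables); in particular every algebra of
finite type over a perfect field of characteristic `p` is F-finite. [cite: Kunz1969, §1] -/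
theorem IsFFinite.of_finiteType {k : Type u} [CommRing k] [ExpChar k p] (hk : IsFFinite p e k)
    (A : Type v) [CommRing A] [Algebra k A] [Algebra.FiniteType k A] : IsFFinite p e A := by
  obtain ⟨n, f, hf⟩ := Algebra.FiniteType.iff_quotient_mvPolynomial''.mp ‹Algebra.FiniteType k A›
  exact (hk.mvPolynomial_fin n).of_surjective f.toRingHom hf

/-- Every algebra of finite type over a perfect field (or perfect ring) of characteristic `p` is
F-finite. [cite: Kunz1969, §1] -/
theorem isFFinite_of_finiteType_of_perfectRing (k : Type u) [CommRing k] (p : ℕ) [ExpChar k p]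
    [PerfectRing k p] (e : ℕ) (A : Type v) [CommRing A] [Algebra k A] [Algebra.FiniteType k A] :
    IsFFinite p e A :=
  (isFFinite_of_perfectRing k p e).of_finiteType A

end Literature.AlgebraicGeometry.Resolution

end
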